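import Summits.SmoothPoincare4.SmoothPoincare4.Theses.RicciFat
import Summits.SmoothPoincare4.SmoothPoincare4.Theorems.EntropyRungSubcylindricalExistenceTransport
import HarnessLib

/-!
# Line `weyl-gap` — the WEYL-GAP THRESHOLD SPLIT of the crux `RicciFat.RicciFatSphere`
  (stmt-SmoothPoincare4-5192; crux-strategist BC2 redirect, 2026-08-17)

Route `route-SmoothPoincare4-RicciFat`, rank-3 crux = the thesis `X` of the route,
`Summit.SmoothPoincare4.SmoothPoincare4.Theses.RicciFat.RicciFatSphere`: every closed smooth
`M ≃ₕ S⁴` carries, for every `δ > 0`, a `C^∞` Riemannian metric with `Ric ≥ 3` and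
`Vol ≥ (1 − δ)·8π²/3`. It is `⇔ SmoothPoincare4` modulo Cheeger–Colding (tree theorem
`ricciFatSphere_iff_spc4`), so by itself it is a RESTATEMENT of the summit; this line is its REDIRECT:
the crux is the conjunction of two statements NEITHER of which is known to imply the summit, cut at the
volume threshold `8π²/9 = Vol(S⁴)/3`:

* `stub_recognitionBeyondWeylGap` — RECOGNITION ("`δ₄ ≥ 2/3` on homotopy 4-spheres"): a closed smooth
  `M ≃ₕ S⁴` with a `C^∞` metric, `Ric ≥ 3`, `Vol > 8π²/9` is diffeomorphic to `S⁴`. OPEN (a consequence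
  of SPC4; Cheeger–Colding's `δ(4)` is ineffective). Its own plan (skeleton of the route item
  `RecognitionBeyondWeylGap`): EINSTEIN REDUCTION (open: a fat-beyond-the-gap homotopy sphere carries an
  EINSTEIN metric `Ric = 3g` fat beyond the gap — volume maximisation under `Ric ≥ 3`) + the KNOWN
  Einstein gap: by Gursky–LeBrun 1999 Thm 1 / Cor 1 (`∫|W^±|² ≥ ∫ s²/24` unless `W^± ≡ 0`, for compact
  oriented Einstein 4-manifolds with `s > 0`) and Chern–Gauss–Bonnet/Hirzebruch
  (`2χ ∓ 3τ = (1/4π²)∫[2|W^∓|² + s²/24]`), an Einstein `Ric = 3g` on a homotopy 4-sphere (`χ = 2`,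
  `τ = 0`) with `Vol > 8π²/9` has `W ≡ 0`, hence constant curvature `1`, hence is the round `S⁴`.
* `stub_fatBeyondWeylGap` — EXISTENCE: every closed smooth `M ≃ₕ S⁴` carries a `C^∞` metric with
  `Ric ≥ 3` and `Vol > 8π²/9`. OPEN (strictly weaker than the crux; strictly stronger than route
  InstantonEntropy's `ExistRicPos`). Its own plan (skeleton of the route item `FatBeyondWeylGap`): ball
  splitting `M = 𝔻⁴ ∪ Δ` + an admissible big-cap fill-in of `Δ` with a volume BUDGET (deficit up to
  `2/3` of the round volume allowed) + Perelman cap gluing with volume bookkeeping.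
* `RicciFatSphere_of` — the crux BY NAME from the two stubs (sorry-free composition
  `RicciFatSphere_of_stubSigs`): fix `M`, `δ`; existence gives a fat metric, recognition a
  diffeomorphism `Φ : M ≃ₘ S⁴`; the round metric pulled back along `Φ` has `Ric = 3g` and
  `Vol = 8π²/3 ≥ (1 − δ)·8π²/3` (`exists_roundMetric_transport`, PROVED in tree — the per-`M` form of
  the proved support item stmt-SmoothPoincare4-5193).

Why the cut is honest (BC2 (c)): `F → S`, `F → X`, `R → S`, `R → X` all FAIL under
`first | exact? | simpa [·] | (unfold ·; simpa) | aesop` and under the plain battery (planner folder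
`bc/*_probe*.lean`, 2026-08-17); no landed `iff`; `S → R` holds (R is a consequence of S, used toward S
here), `S → F` holds by transport. Why it dodges the stuck point of line `birth`: `birth` localises ALL
the open content in one stub (`stub_ricciFatBall`, near-extremal fill-ins for EVERY `ε`), which is again
summit-equivalent modulo known theorems; here the existence side only has to reach a FIXED volume
(`Vol(S⁴)/3`, a deficit budget of `16π²/9`), and the missing `2/3` is moved to a recognition problem
with its own named tools (Gursky–LeBrun gap, Einstein reduction by volume maximisation).

Disproof used: none exists for this crux (`ledger crux ls stmt-SmoothPoincare4-5192`: only
`Lines/birth.*`; no `Disproof.lean`, no `Theorems/RicciFatSphere/Negative/*`; negatives index of the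
summit empty). Barrier honoured: Hang–Wang 2009 Thm 3 (a `Ric ≥ 3` metric on a homotopy sphere that is
round outside a compact domain inside an OPEN hemisphere is globally round) — neither stub asks for a
locally supported modification of the round metric.
-/

noncomputable section

open scoped Manifold ContDiff Topology ENNReal
open ContinuousMap
open Literature.Geometry.Lorentzian (PseudoRiemannianMetric riemannianMeasure)
open Literature.Geometry.Riemannian
open Summit.SmoothPoincare4.SmoothPoincare4.Theses.RicciFat (RicciFatSphere)

-- `Summit.<Summit>.<Problem>`: for the single-conjunct summit the duplicate segment is mandated.
set_option linter.dupNamespace false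
set_option linter.unusedVariables false

namespace Summit.SmoothPoincare4.SmoothPoincare4.Cruxes.RicciFatSphere.WeylGap

/-! ## The two registered stubs (`sorry` lives ONLY here) -/

/-- **Stub R (OPEN — RECOGNITION BEYOND THE WEYL GAP; route item `RicciFat.RecognitionBeyondWeylGap`
verbatim).** A closed smooth homotopy 4-sphere `M` (Hausdorff, second countable, `C^∞` atlas on `ℝ⁴`,
compact, Borel σ-algebra) carrying a `C^∞` Riemannian metric `h` with its Levi-Civita connection,
`Ric_h ≥ 3h` and `Vol(M, h) > 8π²/9 = Vol(S⁴)/3` is diffeomorphic to `S⁴` — "`δ₄ ≥ 2/3` on homotopy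
spheres". Plan: Einstein reduction (open) + Gursky–LeBrun/Gauss–Bonnet Einstein gap (known): an Einstein
`Ric = 3g` on a homotopy 4-sphere with `Vol > 8π²/9` is round. Why it might fail: an exotic `Σ⁴` with
`Ric ≥ 3`, `Vol > 8π²/9` refutes it; volume-maximising sequences may converge to singular `RCD(3,4)`
spaces. Size: open problem.
[cite: GurskyLeBrun1999, Thm. 1 and Cor. 1 (arXiv:math/9807055 p. 8)] [cite: CheegerColding1997, Thm. A.1.10] -/
theorem stub_recognitionBeyondWeylGap :
    ∀ (M : Type) [TopologicalSpace M] [T2Space M] [SecondCountableTopology M]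
      [ChartedSpace (EuclideanSpace ℝ (Fin 4)) M] [IsManifold (𝓡 4) ∞ M] [CompactSpace M]
      [MeasurableSpace M] [BorelSpace M], M ≃ₕ Metric.sphere (0 : EuclideanSpace ℝ (Fin 5)) 1 →
      (∃ h : Bundle.ContMDiffRiemannianMetric (𝓡 4) ∞ (EuclideanSpace ℝ (Fin 4))
          (TangentSpace (𝓡 4) : M → Type _),
        ∃ _ : (Literature.Geometry.Lorentzian.PseudoRiemannianMetric.ofRiemannian h).HasLeviCivita,
          (∀ (x : M) (v : TangentSpace (𝓡 4) x), 3 * h.inner x v v ≤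
            (Literature.Geometry.Lorentzian.PseudoRiemannianMetric.ofRiemannian h).ricci x v v) ∧
          ENNReal.ofReal (8 * Real.pi ^ 2 / 9) <
            Literature.Geometry.Lorentzian.riemannianMeasure h Set.univ) →
      Nonempty (M ≃ₘ⟮𝓡 4, 𝓡 4⟯ Metric.sphere (0 : EuclideanSpace ℝ (Fin 5)) 1) := by
  sorry

/-- **Stub F (OPEN — FAT BEYOND THE WEYL GAP; route item `RicciFat.FatBeyondWeylGap` verbatim).**
Every closed smooth homotopy 4-sphere `M` carries a `C^∞` Riemannian metric `h` with its Levi-Civita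
connection, `Ric_h ≥ 3h` and `Vol(M, h) > 8π²/9 = Vol(S⁴)/3`. Plan: ball splitting `M = 𝔻⁴ ∪_φ Δ`
(known) + admissible big-cap fill-in of `Δ` with a volume budget (open) + Perelman cap gluing with
volume bookkeeping (known modulo the smoothing rider). Why it might fail: false iff some homotopy
4-sphere is Ricci-thin below `Vol(S⁴)/3`, e.g. iff an exotic `Σ⁴` carries no `Ric > 0` metric at all;
Hang–Wang Thm 3 forbids witnesses that are round outside a sub-hemispherical domain. Size: open
problem. [cite: Perelman1997BigVolume, §4] [cite: HangWang2009, Thm. 3] -/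
theorem stub_fatBeyondWeylGap :
    ∀ (M : Type) [TopologicalSpace M] [T2Space M] [SecondCountableTopology M]
      [ChartedSpace (EuclideanSpace ℝ (Fin 4)) M] [IsManifold (𝓡 4) ∞ M] [CompactSpace M]
      [MeasurableSpace M] [BorelSpace M], M ≃ₕ Metric.sphere (0 : EuclideanSpace ℝ (Fin 5)) 1 →
      ∃ h : Bundle.ContMDiffRiemannianMetric (𝓡 4) ∞ (EuclideanSpace ℝ (Fin 4))
          (TangentSpace (𝓡 4) : M → Type _),
        ∃ _ : (Literature.Geometry.Lorentzian.PseudoRiemannianMetric.ofRiemannian h).HasLeviCivita,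
          (∀ (x : M) (v : TangentSpace (𝓡 4) x), 3 * h.inner x v v ≤
            (Literature.Geometry.Lorentzian.PseudoRiemannianMetric.ofRiemannian h).ricci x v v) ∧
          ENNReal.ofReal (8 * Real.pi ^ 2 / 9) <
            Literature.Geometry.Lorentzian.riemannianMeasure h Set.univ := by
  sorry

/-! ## The composition: the two stubs prove the crux BY NAME (no `sorry` below this line) -/

/-- **Composition with explicit hypotheses** (`stub_R-sig → stub_F-sig → crux`): fix `M ≃ₕ S⁴` and
`δ > 0`; the existence stub gives a fat metric, the recognition stub a diffeomorphism `Φ : M ≃ₘ S⁴`,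
and the round metric pulled back along `Φ` has `Ric = 3g`, `Vol = 8π²/3 ≥ (1 − δ)·8π²/3`
(`exists_roundMetric_transport`). [cite: ONeill1983, Ch. 3, Prop. 3.59] -/
theorem RicciFatSphere_of_stubSigs
    (hR : ∀ (M : Type) [TopologicalSpace M] [T2Space M] [SecondCountableTopology M]
      [ChartedSpace (EuclideanSpace ℝ (Fin 4)) M] [IsManifold (𝓡 4) ∞ M] [CompactSpace M]
      [MeasurableSpace M] [BorelSpace M], M ≃ₕ Metric.sphere (0 : EuclideanSpace ℝ (Fin 5)) 1 →
      (∃ h : Bundle.ContMDiffRiemannianMetric (𝓡 4) ∞ (EuclideanSpace ℝ (Fin 4))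
          (TangentSpace (𝓡 4) : M → Type _),
        ∃ _ : (Literature.Geometry.Lorentzian.PseudoRiemannianMetric.ofRiemannian h).HasLeviCivita,
          (∀ (x : M) (v : TangentSpace (𝓡 4) x), 3 * h.inner x v v ≤
            (Literature.Geometry.Lorentzian.PseudoRiemannianMetric.ofRiemannian h).ricci x v v) ∧
          ENNReal.ofReal (8 * Real.pi ^ 2 / 9) <
            Literature.Geometry.Lorentzian.riemannianMeasure h Set.univ) →
      Nonempty (M ≃ₘ⟮𝓡 4, 𝓡 4⟯ Metric.sphere (0 : EuclideanSpace ℝ (Fin 5)) 1))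
    (hF : ∀ (M : Type) [TopologicalSpace M] [T2Space M] [SecondCountableTopology M]
      [ChartedSpace (EuclideanSpace ℝ (Fin 4)) M] [IsManifold (𝓡 4) ∞ M] [CompactSpace M]
      [MeasurableSpace M] [BorelSpace M], M ≃ₕ Metric.sphere (0 : EuclideanSpace ℝ (Fin 5)) 1 →
      ∃ h : Bundle.ContMDiffRiemannianMetric (𝓡 4) ∞ (EuclideanSpace ℝ (Fin 4))
          (TangentSpace (𝓡 4) : M → Type _),
        ∃ _ : (Literature.Geometry.Lorentzian.PseudoRiemannianMetric.ofRiemannian h).HasLeviCivita,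
          (∀ (x : M) (v : TangentSpace (𝓡 4) x), 3 * h.inner x v v ≤
            (Literature.Geometry.Lorentzian.PseudoRiemannianMetric.ofRiemannian h).ricci x v v) ∧
          ENNReal.ofReal (8 * Real.pi ^ 2 / 9) <
            Literature.Geometry.Lorentzian.riemannianMeasure h Set.univ) :
    RicciFatSphere := by
  intro M _ _ _ _ _ _ _ _ e δ hδ
  -- existence: a fat metric; recognition: hence a diffeomorphism onto `S⁴`
  obtain ⟨h, hLC, hRic, hVol⟩ := hF M e
  obtain ⟨Φ⟩ := hR M e ⟨h, hLC, hRic, hVol⟩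
  -- transport the round metric along `Φ`
  obtain ⟨g, hLCg, hg, hRicg, hVolg⟩ :=
    Summit.SmoothPoincare4.SmoothPoincare4.Theorems.exists_roundMetric_transport Φ
  have hback : PseudoRiemannianMetric.ofRiemannian (g.toContMDiffRiemannianMetric hg) = g := by
    ext; rfl
  haveI hLC' : (PseudoRiemannianMetric.ofRiemannian (g.toContMDiffRiemannianMetric hg)).HasLeviCivita :=
    (PseudoRiemannianMetric.ofRiemannian _).hasLeviCivita
  have hRic' : ∀ (g' : PseudoRiemannianMetric (𝓡 4) ∞ (EuclideanSpace ℝ (Fin 4))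
      (TangentSpace (𝓡 4) : M → Type _)) [g'.HasLeviCivita], g' = g →
      ∀ (x : M) (v : TangentSpace (𝓡 4) x), 3 * g'.val x v v ≤ g'.ricci x v v := by
    rintro g' _ rfl x v
    exact (hRicg x v v).symm.le
  refine ⟨g.toContMDiffRiemannianMetric hg, hLC', fun x v ↦ hRic' _ hback x v, ?_⟩
  rw [hVolg]
  exact ENNReal.ofReal_le_ofReal (by nlinarith [Real.pi_pos, sq_nonneg Real.pi])

/-- **THE SKELETON THEOREM.** The crux `Summit.SmoothPoincare4.SmoothPoincare4.Theses.RicciFat.RicciFatSphere`,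
concluded BY NAME from the two DECLARED stubs `stub_recognitionBeyondWeylGap`, `stub_fatBeyondWeylGap`
(the only `sorry`s of the file) through the sorry-free composition `RicciFatSphere_of_stubSigs`.
[cite: GurskyLeBrun1999, Thm. 1] -/
theorem RicciFatSphere_of : RicciFatSphere :=
  RicciFatSphere_of_stubSigs stub_recognitionBeyondWeylGap stub_fatBeyondWeylGap

end Summit.SmoothPoincare4.SmoothPoincare4.Cruxes.RicciFatSphere.WeylGap

end
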